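import Summits.ResolutionOfSingularities.ResolutionOfSingularities.Theorems.UniformComplexityPrimeModelTransferOfFamilyResolution
import Summits.ResolutionOfSingularities.ResolutionOfSingularities.Theorems.UniformComplexityCampaignW82FamilyResolutionOneFibre
import Literature.AlgebraicGeometry.Morphisms.OpenSmoothFibreLocus
import Literature.AlgebraicGeometry.Morphisms.IsoOverOpen
import Literature.AlgebraicGeometry.Resolution.SmoothStalksRegular
import Mathlib.AlgebraicGeometry.Morphisms.UniversallyOpen
import Mathlib.RingTheory.Ideal.GoingUp
import HarnessLib

/-!
# Crux `PrimeModelTransfer` (stmt-ResolutionOfSingularities-8933), door 2 of slot W8.2: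
# ONE SMOOTH CLOSED FIBRE of a flat proper modification of the family suffices (E7 direction)

Route `ResolutionOfSingularities/UniformComplexity`. Gen 5 of this seat proved the crux slice
EQUIVALENT to RESOLUTION IN FAMILIES over `𝔽̄_p` (`CampaignW82.FamilyResolution`, p526769; links
p530650/p532272): a simultaneous weak resolution of ALL field-valued fibres of every proper
`𝔽̄_p`-family after an algebraic finite-type base extension. THIS FILE proves that ONE CLOSED FIBRE
suffices, flatly — the closed-fibre form recommended by the crux kernel's lead c3 (tree file
`Summits/…/Cruxes/PrimeFieldToPerfect/KERNEL-c3.md` §1 «(E7) one smooth closed fibre suffices»,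
targets (5.1)/(5.5)) — for the OURS statements `CampaignW82.SmoothFamilyResolution`,
`CampaignW82.FamilyResolutionOneFibre` (gen-6 module
`Theorems/UniformComplexityCampaignW82FamilyResolutionOneFibre.lean`, p540376):

* `smooth_of_isPullback_of_range_subset` — base change along a morphism landing in an open over
  which `f` is smooth is smooth; `isWeakResolution_pullback_of_smooth` — the field-valued fibres of a
  proper `G : 𝒴 → 𝒳'` with `𝒴 → S` smooth and `G` an isomorphism over an open meeting the fibre are
  weak resolutions; hence `familyResolution_of_smoothFamilyResolution` and
  `familyResolutionOneFibre_of_smoothFamilyResolution` (any closed point; smooth ⇒ flat);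
* `hasResolution_of_familyResolutionOneFibre` — **`FamilyResolutionOneFibre k` ⇒ every integral
  separated scheme of finite type over every ALGEBRAICALLY CLOSED `K ⊇ k` has a resolution** (EGA IV₃
  12.2.4 (iii) via the tree's `Morphisms.exists_smooth_morphismRestrict_of_smooth_fiber`; the
  `K`-point of the crux's variety lifts to an INJECTIVE `A' → K`, i.e. to the generic point of
  `Spec A'`, which lies in the open where the modified family is smooth; non-emptiness of the
  isomorphism locus on the `K`-fibre by `Flat.generalizingMap`);
* `algClosedRes_of_familyResolutionOneFibre`, `algClosedRes_of_smoothFamilyResolution` — for `k`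
  algebraic over `ZMod p`, either family form gives `CampaignW82.AlgClosedRes p`.

[OURS · LADDER-RESOLUTION L1, slot W8.2 (prime-field / universality transfer), door 2
UniformComplexity] Theorems over the summit's own route and OURS names; NOT statements of, and
attributing nothing to, Hironaka's 2017 manuscript (the OURS `Prop`s replace the role of §17 ¶2,
p.89 l.59–62, see the definition modules). AI-written; weaker than expert review. Barrier
bookkeeping: no resolution is base-changed along an inseparable field extension; smoothness of the
`K`-fibre comes from smoothness of the modified family over an open of the extended base, obtained
from ONE smooth closed fibre by openness of the smooth locus + properness (EGA IV₄ 17.5.1), never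
from regularity of a total space.

Sources: A. Grothendieck, J. Dieudonné, EGA IV₃ (1966) Thm. 12.2.4 (iii), Thm. 8.8.2 (ii); EGA IV₄
(1967) Thm. 17.5.1; The Stacks Project, Tags 01V8, 01ZM, 09GU. [cite: EGAIV3, Thm. 12.2.4 (iii)]
[cite: EGAIV4, Thm. 17.5.1] [cite: StacksProject, Tag 01V8]
-/

noncomputable section

set_option linter.dupNamespace false -- mandated namespace of this single-conjunct summit

open CategoryTheory CategoryTheory.Limits AlgebraicGeometry TopologicalSpace
open Literature.AlgebraicGeometry.Resolution

namespace Summit.ResolutionOfSingularities.ResolutionOfSingularities.Theorems.PrimeModelTransfer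

open Literature.AlgebraicGeometry.Limits
open Literature.AlgebraicGeometry.Motives (SchemeOver specOver)

set_option backward.isDefEq.respectTransparency false

/-! ## Two base-change lemmas -/

/-- **Base change along a morphism landing in a smooth locus.** If `f : X → Y` is smooth over the
open `V ⊆ Y` (`Smooth (f ∣_ V)`), `c : Z → Y` has image inside `V`, and `(t, v; f, c)` is a pullback
square, then `v : P → Z` is smooth: `c` and `t` factor through `V` and `f⁻¹(V)` (open immersions,
`IsOpenImmersion.lift`), the square is the pasting of a square over `f ∣_ V` with
`isPullback_morphismRestrict`, and smoothness is stable under base change. (Same argument as the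
tree's `Resolution.smooth_fiberToSpecResidueField_of_mem`, for an arbitrary `c` instead of
`Spec κ(y) → Y`.) [cite: EGAIV4, Prop. 17.3.3 (iii)] -/
theorem smooth_of_isPullback_of_range_subset {P X Y Z : Scheme.{0}} {f : X ⟶ Y} (V : Y.Opens)
    [Smooth (f ∣_ V)] {c : Z ⟶ Y} {t : P ⟶ X} {v : P ⟶ Z} (sq : IsPullback t v f c)
    (hc : Set.range c ⊆ (V : Set Y)) : Smooth v := by
  have hr : Set.range c ⊆ Set.range V.ι := by rwa [Scheme.Opens.range_ι]
  let l := IsOpenImmersion.lift V.ι c hr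
  have hl : l ≫ V.ι = c := IsOpenImmersion.lift_fac _ _ _
  have hr' : Set.range t ⊆ Set.range (f ⁻¹ᵁ V).ι := by
    rw [Scheme.Opens.range_ι]
    rintro _ ⟨z, rfl⟩
    change f (t z) ∈ V
    rw [← Scheme.Hom.comp_apply, sq.w, Scheme.Hom.comp_apply]
    exact hc ⟨v z, rfl⟩
  let m := IsOpenImmersion.lift (f ⁻¹ᵁ V).ι t hr'
  have hm : m ≫ (f ⁻¹ᵁ V).ι = t := IsOpenImmersion.lift_fac _ _ _
  have s : IsPullback (m ≫ (f ⁻¹ᵁ V).ι) v f (l ≫ V.ι) := by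
    rw [hm, hl]
    exact sq
  have p : m ≫ (f ∣_ V) = v ≫ l := by
    rw [← cancel_mono V.ι, Category.assoc, Category.assoc, morphismRestrict_ι, hl,
      ← Category.assoc, hm, sq.w]
  have sq' : IsPullback m v (f ∣_ V) l := IsPullback.of_right s p (isPullback_morphismRestrict f V).flip
  exact MorphismProperty.of_isPullback (P := @Smooth) sq' inferInstance

/-- **The field-valued fibres of a smooth proper modification are weak resolutions.** Let
`f' : 𝒳' → S` be separated, `G : 𝒴 → 𝒳'` proper with `𝒴 → S` smooth and `G` an isomorphism over the
open `W ⊆ 𝒳'`, and let `c : Spec Ω → S` (`Ω` a field) be a point over which `W` has a point. Then the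
fibre `G_c : 𝒴 ×_{𝒳'} 𝒳'_c → 𝒳'_c := 𝒳' ×_S Spec Ω` is a weak resolution
(`CampaignW82.IsWeakResolution`): proper (base change), regular source (the fibre is smooth over the
field `Ω`, `isRegularLocalRing_stalk_of_smooth_of_field`), an isomorphism over the preimage of `W`
(`Morphisms.isIso_morphismRestrict_pullback_snd`), which is non-empty (a point of the fibre product
over the given point of `W` and the point of `Spec Ω`). This is step (7) of gen 5's spreading theorem
p529834, isolated. [cite: StacksProject, Tag 01V8] -/
theorem isWeakResolution_pullback_of_smooth {𝒴 𝒳' S : Scheme.{0}} (f' : 𝒳' ⟶ S) [IsSeparated f']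
    (G : 𝒴 ⟶ 𝒳') [IsProper G] [Smooth (G ≫ f')] (W : 𝒳'.Opens) [IsIso (G ∣_ W)]
    (Ω : Type) [Field Ω] (c : Spec (.of Ω) ⟶ S)
    (hW : ∃ x : 𝒳', x ∈ W ∧ f' x ∈ Set.range c) :
    CampaignW82.IsWeakResolution (pullback.snd G (pullback.fst f' c)) := by
  let gc : pullback f' c ⟶ 𝒳' := pullback.fst f' c
  let pc : pullback f' c ⟶ Spec (.of Ω) := pullback.snd f' c
  let Gc : pullback G gc ⟶ pullback f' c := pullback.snd G gc
  change CampaignW82.IsWeakResolution Gc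
  have HG : IsPullback (pullback.fst G gc) Gc G gc := IsPullback.of_hasPullback G gc
  have Hc : IsPullback gc pc f' c := IsPullback.of_hasPullback f' c
  have Hq : IsPullback (pullback.fst G gc) (Gc ≫ pc) (G ≫ f') c := HG.paste_vert Hc
  haveI : Smooth (Gc ≫ pc) := MorphismProperty.of_isPullback (P := @Smooth) Hq inferInstance
  haveI : IsProper Gc := inferInstance
  have hreg : Scheme.IsRegular (pullback G gc) := fun y =>
    isRegularLocalRing_stalk_of_smooth_of_field (Gc ≫ pc) y
  haveI : IsIso (Gc ∣_ (gc ⁻¹ᵁ W)) :=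
    Literature.AlgebraicGeometry.Morphisms.isIso_morphismRestrict_pullback_snd G gc W
  obtain ⟨x, hxW, ⟨t, ht⟩⟩ := hW
  obtain ⟨z, hz, -⟩ := Scheme.Pullback.exists_preimage_pullback (f := f') (g := c) x t ht.symm
  have hne : ((gc ⁻¹ᵁ W : (pullback f' c).Opens) : Set ↥(pullback f' c)).Nonempty :=
    ⟨z, show gc z ∈ W by rw [show gc z = x from hz]; exact hxW⟩
  exact ⟨inferInstance, hreg, gc ⁻¹ᵁ W, hne, inferInstance⟩

/-! ## The strong family form implies the other two -/

/-- **`SmoothFamilyResolution k → FamilyResolution k`**: the field-valued fibres of the smooth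
modified family are weak resolutions (`isWeakResolution_pullback_of_smooth`; the open `W` meets every
fibre). [folklore] -/
theorem familyResolution_of_smoothFamilyResolution (k : Type) [Field k]
    (h : CampaignW82.SmoothFamilyResolution k) : CampaignW82.FamilyResolution k := by
  intro A _ _ _ hAft 𝒳 f hf hint
  obtain ⟨A', _, _, _, hinj, hft, halg, 𝒴, G, W, hGp, hsm, hWiso, hW⟩ := h A hAft 𝒳 f hf hint
  refine ⟨A', inferInstance, inferInstance, inferInstance, hinj, hft, halg, 𝒴, G, fun Ω _ φ => ?_⟩
  haveI := hGp; haveI := hsm; haveI := hWiso; haveI := hf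
  haveI : Nonempty ↥(Spec (CommRingCat.of Ω)) := inferInstanceAs (Nonempty (PrimeSpectrum Ω))
  let pt : ↥(Spec (CommRingCat.of Ω)) := Nonempty.some inferInstance
  obtain ⟨x, hxW, hx⟩ := hW ((Spec.map (CommRingCat.ofHom φ)) pt)
  exact isWeakResolution_pullback_of_smooth _ G W Ω (Spec.map (CommRingCat.ofHom φ))
    ⟨x, hxW, ⟨pt, hx.symm⟩⟩

/-- **`SmoothFamilyResolution k → FamilyResolutionOneFibre k`**: take for `s` ANY closed point of
`Spec A'` (a maximal ideal of the non-trivial ring `A'`); the smooth `𝒴 → Spec A'` is flat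
(Mathlib: smooth ⇒ flat) and its fibre over `s` is smooth (base change). [folklore] -/
theorem familyResolutionOneFibre_of_smoothFamilyResolution (k : Type) [Field k]
    (h : CampaignW82.SmoothFamilyResolution k) : CampaignW82.FamilyResolutionOneFibre k := by
  intro A _ _ _ hAft 𝒳 f hf hint
  obtain ⟨A', _, _, _, hinj, hft, halg, 𝒴, G, W, hGp, hsm, hWiso, hW⟩ := h A hAft 𝒳 f hf hint
  haveI := hsm
  obtain ⟨𝔪, h𝔪⟩ := Ideal.exists_maximal A'
  let s : ↥(Spec (CommRingCat.of A')) := (⟨𝔪, h𝔪.isPrime⟩ : PrimeSpectrum A')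
  have hs : IsClosed ({s} : Set ↥(Spec (CommRingCat.of A'))) :=
    (PrimeSpectrum.isClosed_singleton_iff_isMaximal _).mpr h𝔪
  refine ⟨A', inferInstance, inferInstance, inferInstance, hinj, hft, halg, 𝒴, G, W, s, hs, hGp, hWiso,
    hW s, fun y _ => Flat.stalkMap _ y, ?_⟩
  change Smooth (pullback.snd _ _)
  infer_instance

/-! ## ONE SMOOTH CLOSED FIBRE ⇒ resolution over every algebraically closed `K ⊇ k` -/

/-- **One-closed-fibre resolution in families over `k` implies resolution over every algebraically
closed extension `K` of `k`.** Let `k ⊆ K` be fields with `K` algebraically closed and assume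
`CampaignW82.FamilyResolutionOneFibre k`. Then every integral separated `K`-scheme of finite type has
a resolution. Proof: reduce to an integral PROJECTIVE `Y → Spec K` (Nagata + Chow:
`hasResolution_of_forall_proper`, `ChowLemmaRing.chow_proper`, `Scheme.HasResolution.of_isBirational`);
`Y = X' ×_R Spec K` for a proper `F : X' → Spec R` over a finitely generated `k`-subalgebra
`ψ : R ⊆ K` (`exists_isPullback_proper_subalgebra`, p528212) with integral geometric generic fibre
(`(Frac R)^{alg}` embeds into `K`); the hypothesis gives `R → A'` algebraic finite-type injective,
`G : 𝒴 → X' ×_R Spec A'` proper and an isomorphism over `W`, a closed `s` with `W ∩ (X' ×_R A')_s ≠ ∅`,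
`q : 𝒴 → Spec A'` flat over `s` with smooth fibre `q⁻¹(s)`; EGA IV₃ 12.2.4 (iii) (tree lemma
`Morphisms.exists_smooth_morphismRestrict_of_smooth_fiber`; `q` is proper, of finite presentation
over the Noetherian `Spec A'`) makes `q` SMOOTH over an open `V ∋ s`; the `K`-point `ψ` lifts to
`τ : A' → K` (`IsAlgClosed.lift`), INJECTIVE because `A'` is a domain algebraic over `R`
(`Ideal.comap_ne_bot_of_algebraic_mem`), so `Spec τ` hits the generic point of `Spec A'`, which
generizes `s` and lies in `V`; hence the `K`-fibre `𝒴_K → Y` is proper with `𝒴_K` smooth over `K`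
(`smooth_of_isPullback_of_range_subset`), so regular, and is an isomorphism over the preimage of `W`,
non-empty since `q|_V` is flat hence generalizing (`Flat.generalizingMap`: the point of `G⁻¹(W)` over
`s` generizes to one over the generic point, still in the open `G⁻¹(W)`); conclude by
`hasResolution_of_isIso_morphismRestrict` (p483756). [cite: EGAIV3, Thm. 12.2.4 (iii)]
[cite: StacksProject, Tag 01ZM] -/
theorem hasResolution_of_familyResolutionOneFibre (k K : Type) [Field k] [Field K] [IsAlgClosed K]
    [Algebra k K] (hOF : CampaignW82.FamilyResolutionOneFibre k)
    (X : Scheme.{0}) (f : X ⟶ Spec (.of K)) [IsSeparated f] [LocallyOfFiniteType f]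
    [QuasiCompact f] [IsIntegral X] : Scheme.HasResolution X := by
  classical
  -- ### Step 0: it suffices to resolve integral PROJECTIVE `K`-schemes (Nagata + Chow)
  refine hasResolution_of_forall_proper K (fun Y₀ g₀ hg₀ hY₀ => ?_) X f
  haveI := hg₀
  haveI := hY₀
  obtain ⟨n, Y, ρ, ι, hY, hι, hρ, -, hw, U, hUd, hUpre, hUiso⟩ :=
    ChowLemmaRing.chow_proper (R := K) Y₀ g₀
  haveI := hρ
  haveI := hι
  haveI := hY
  let g : Y ⟶ Spec (.of K) := ρ ≫ g₀
  have hproj : ChowLemmaRing.IsProjOver (Over.mk g : SchemeOver K) := ⟨n, Over.homMk ι hw, hι⟩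
  refine Scheme.HasResolution.of_isBirational ρ ⟨U, hUd, hUpre, hUiso⟩ ?_
  -- ### Step 1: a proper model `F : X' → Spec R` over a finitely generated `k`-subalgebra `R ⊆ K`
  obtain ⟨R, _, _, _, ψ, X', F, π, hψ, hRft, hF, hsq⟩ :=
    exists_isPullback_proper_subalgebra k K g hproj
  haveI := hRft
  haveI := hF
  letI : Algebra R K := ψ.toAlgebra
  haveI : FaithfulSMul R K := (faithfulSMul_iff_algebraMap_injective R K).mpr hψ
  -- ### Step 2: the geometric generic fibre `X' ×_R Spec (Frac R)^alg` is integral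
  let L : Type := AlgebraicClosure (FractionRing R)
  haveI : Algebra.IsAlgebraic R (FractionRing R) :=
    IsLocalization.isAlgebraic (FractionRing R) (nonZeroDivisors R)
  haveI : Algebra.IsAlgebraic R L := Algebra.IsAlgebraic.trans R (FractionRing R) L
  haveI : FaithfulSMul R L := (faithfulSMul_iff_algebraMap_injective R L).mpr (by
    rw [IsScalarTower.algebraMap_eq R (FractionRing R) L]
    exact (algebraMap (FractionRing R) L).injective.comp (IsFractionRing.injective R (FractionRing R)))
  let σ : L →ₐ[R] K := IsAlgClosed.lift
  have hσ : σ.toRingHom.comp (algebraMap R L) = ψ := σ.comp_algebraMap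
  let iL : Spec (.of L) ⟶ Spec (.of R) := Spec.map (CommRingCat.ofHom (algebraMap R L))
  let jσ : Spec (.of K) ⟶ Spec (.of L) := Spec.map (CommRingCat.ofHom σ.toRingHom)
  have hjσ : jσ ≫ iL = Spec.map (CommRingCat.ofHom ψ) := by
    change Spec.map _ ≫ Spec.map _ = _
    rw [← Spec.map_comp, ← CommRingCat.ofHom_comp, hσ]
  let XL : Scheme.{0} := pullback F iL
  let FL : XL ⟶ Spec (.of L) := pullback.snd F iL
  let m : Y ⟶ XL := pullback.lift π (g ≫ jσ) (by rw [Category.assoc, hjσ]; exact hsq.w)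
  have hsqm : IsPullback m g FL jσ := by
    have outer : IsPullback (m ≫ pullback.fst F iL) g F (jσ ≫ iL) := by
      rw [pullback.lift_fst, hjσ]; exact hsq
    exact outer.of_right (pullback.lift_snd _ _ _) (IsPullback.of_hasPullback F iL)
  haveI : Subsingleton ↥(Spec (CommRingCat.of L)) := inferInstanceAs (Subsingleton (PrimeSpectrum L))
  haveI : Subsingleton ↥(Spec (CommRingCat.of K)) := inferInstanceAs (Subsingleton (PrimeSpectrum K))
  haveI : Nonempty ↥(Spec (CommRingCat.of K)) := inferInstanceAs (Nonempty (PrimeSpectrum K))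
  haveI : Flat jσ := by
    letI : Algebra L K := σ.toRingHom.toAlgebra
    haveI hflat : Module.Flat L K := inferInstance
    rw [show jσ = Spec.map (CommRingCat.ofHom (algebraMap L K)) from rfl, Flat.SpecMap_iff,
      CommRingCat.hom_ofHom]
    exact RingHom.flat_algebraMap_iff.mpr hflat
  haveI : Surjective jσ := inferInstance
  haveI : Flat m := MorphismProperty.of_isPullback (P := @Flat) hsqm.flip ‹Flat jσ›
  haveI : Surjective m := MorphismProperty.of_isPullback (P := @Surjective) hsqm.flip ‹Surjective jσ›
  haveI : IsReduced XL := Literature.AlgebraicGeometry.Morphisms.isReduced_of_flat_of_surjective m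
  haveI : IrreducibleSpace XL := Function.Surjective.irreducibleSpace m.continuous m.surjective
  have hint : IsIntegral XL := isIntegral_of_irreducibleSpace_of_isReduced XL
  -- ### Step 3: the one-closed-fibre datum over an algebraic finite-type extension `A'`
  obtain ⟨A', _, _, _, hinj, hA'ft, halg, 𝒴, G, W, s, -, hGp, hWiso, ⟨x, hxW, hxs⟩, hflat, hsm⟩ :=
    hOF R hRft X' F hF hint
  haveI := hGp
  haveI := hWiso
  haveI := hA'ft
  haveI : IsNoetherianRing R := Algebra.FiniteType.isNoetherianRing k R
  haveI : IsNoetherianRing A' := Algebra.FiniteType.isNoetherianRing R A'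
  let ιA : Spec (.of A') ⟶ Spec (.of R) := Spec.map (CommRingCat.ofHom (algebraMap R A'))
  let F' : pullback F ιA ⟶ Spec (.of A') := pullback.snd F ιA
  let q : 𝒴 ⟶ Spec (.of A') := G ≫ F'
  haveI : IsProper F' := inferInstance
  haveI : IsSeparated F' := inferInstance
  haveI : IsProper q := inferInstance
  haveI : LocallyOfFinitePresentation q := by
    rw [HasRingHomProperty.iff_appLE (P := @LocallyOfFinitePresentation)]
    intro U V e
    haveI := IsLocallyNoetherian.component_noetherian (X := Spec (.of A')) U
    exact RingHom.FinitePresentation.of_finiteType.mp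
      (HasRingHomProperty.appLE @LocallyOfFiniteType q inferInstance U V e)
  -- ### Step 4 (EGA IV₃ 12.2.4 (iii)): `q` is smooth over an open `V ∋ s`
  obtain ⟨V, hsV, hVsm⟩ :=
    Literature.AlgebraicGeometry.Morphisms.exists_smooth_morphismRestrict_of_smooth_fiber q hflat hsm
  haveI := hVsm
  -- ### Step 5: the `K`-point `R ⊆ K` lifts to an INJECTIVE `τ : A' → K`, i.e. to the generic point
  haveI : FaithfulSMul R A' := (faithfulSMul_iff_algebraMap_injective R A').mpr hinj
  let τ : A' →ₐ[R] K := IsAlgClosed.lift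
  have hτ : τ.toRingHom.comp (algebraMap R A') = ψ := τ.comp_algebraMap
  have hτinj : Function.Injective τ.toRingHom := by
    rw [injective_iff_map_eq_zero]
    intro a ha
    by_contra ha0
    have h1 : (RingHom.ker τ.toRingHom).comap (algebraMap R A') ≠ ⊥ :=
      Ideal.comap_ne_bot_of_algebraic_mem ha0 ((RingHom.mem_ker).mpr ha)
        (Algebra.IsAlgebraic.isAlgebraic a)
    apply h1
    rw [eq_bot_iff]
    intro r hr
    rw [Ideal.mem_comap, RingHom.mem_ker, ← RingHom.comp_apply, hτ] at hr
    exact (Ideal.mem_bot).mpr ((injective_iff_map_eq_zero ψ).mp hψ r hr)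
  let cτ : Spec (.of K) ⟶ Spec (.of A') := Spec.map (CommRingCat.ofHom τ.toRingHom)
  have hcτ : cτ ≫ ιA = Spec.map (CommRingCat.ofHom ψ) := by
    change Spec.map _ ≫ Spec.map _ = _
    rw [← Spec.map_comp, ← CommRingCat.ofHom_comp, hτ]
  -- the image of `Spec K` is the generic point: it generizes every point of `Spec A'`
  have hgen : ∀ (t : ↥(Spec (CommRingCat.of K))) (z : ↥(Spec (CommRingCat.of A'))), cτ t ⤳ z := by
    intro t z
    have hbot : (cτ t).asIdeal = ⊥ := by
      change Ideal.comap τ.toRingHom t.asIdeal = ⊥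
      rw [Ideal.eq_bot_of_prime t.asIdeal]
      exact Ideal.comap_bot_of_injective _ hτinj
    exact (PrimeSpectrum.le_iff_specializes _ _).mp
      ((PrimeSpectrum.asIdeal_le_asIdeal _ _).mp (by rw [hbot]; exact bot_le))
  have hcτV : Set.range cτ ⊆ (V : Set ↥(Spec (CommRingCat.of A'))) := by
    rintro _ ⟨t, rfl⟩
    exact (hgen t s).mem_open V.2 hsV
  -- ### Step 6: the `K`-fibre `G_K : 𝒴_K → (X' ×_R A') ×_{A'} K ≅ Y` is a weak resolution
  let Xτ : Scheme.{0} := pullback F' cτ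
  let gτ : Xτ ⟶ pullback F ιA := pullback.fst F' cτ
  let pτ : Xτ ⟶ Spec (.of K) := pullback.snd F' cτ
  let Gτ : pullback G gτ ⟶ Xτ := pullback.snd G gτ
  have HG : IsPullback (pullback.fst G gτ) Gτ G gτ := IsPullback.of_hasPullback G gτ
  have Hc : IsPullback gτ pτ F' cτ := IsPullback.of_hasPullback F' cτ
  have Hq : IsPullback (pullback.fst G gτ) (Gτ ≫ pτ) q cτ := HG.paste_vert Hc
  haveI : Smooth (Gτ ≫ pτ) := smooth_of_isPullback_of_range_subset V Hq hcτV
  haveI : IsProper (Gτ ≫ pτ) := MorphismProperty.of_isPullback (P := @IsProper) Hq inferInstance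
  haveI : IsSeparated pτ := inferInstance
  haveI : IsProper Gτ := IsProper.of_comp Gτ pτ
  have hreg : Scheme.IsRegular (pullback G gτ) := fun y =>
    isRegularLocalRing_stalk_of_smooth_of_field (Gτ ≫ pτ) y
  haveI : IsIso (Gτ ∣_ (gτ ⁻¹ᵁ W)) :=
    Literature.AlgebraicGeometry.Morphisms.isIso_morphismRestrict_pullback_snd G gτ W
  -- a point of `G⁻¹(W)` over `s` …
  let y₀' : ↥(G ⁻¹ᵁ W) := inv (G ∣_ W) ⟨x, hxW⟩
  let y₀ : ↥𝒴 := (G ⁻¹ᵁ W).ι y₀'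
  have hy₀W : y₀ ∈ G ⁻¹ᵁ W := by
    change (G ⁻¹ᵁ W).ι y₀' ∈ G ⁻¹ᵁ W
    rw [show ((G ⁻¹ᵁ W).ι y₀' : ↥𝒴) = (y₀' : ↥𝒴) from rfl]
    exact y₀'.2
  have hGy₀ : G y₀ = x := by
    change ((G ⁻¹ᵁ W).ι ≫ G) y₀' = x
    rw [← morphismRestrict_ι, Scheme.Hom.comp_apply]
    change ((W.ι) ((inv (G ∣_ W) ≫ (G ∣_ W)) ⟨x, hxW⟩)) = x
    rw [IsIso.inv_hom_id]
    rfl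
  have hqy₀ : q y₀ = s := by
    change F' (G y₀) = s
    rw [hGy₀]; exact hxs
  -- … generizes, along the flat `q|_V`, to a point of `G⁻¹(W)` over the generic point
  haveI : Nonempty ↥(Spec (CommRingCat.of K)) := inferInstanceAs (Nonempty (PrimeSpectrum K))
  let pt : ↥(Spec (CommRingCat.of K)) := Nonempty.some inferInstance
  have hy₀V : y₀ ∈ q ⁻¹ᵁ V := by
    change q y₀ ∈ V
    rw [hqy₀]; exact hsV
  let a : ↥(q ⁻¹ᵁ V) := ⟨y₀, hy₀V⟩
  let b : ↥V := ⟨cτ pt, hcτV ⟨pt, rfl⟩⟩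
  have hab : b ⤳ (q ∣_ V) a := by
    rw [← (V.ι).isOpenEmbedding.isEmbedding.isInducing.specializes_iff]
    have h1 : (V.ι) ((q ∣_ V) a) = q y₀ := by
      rw [← Scheme.Hom.comp_apply, morphismRestrict_ι, Scheme.Hom.comp_apply]
      rfl
    rw [h1, hqy₀]
    exact hgen pt s
  obtain ⟨a', ha'a, ha'b⟩ := Flat.generalizingMap (q ∣_ V) hab
  let y₁ : ↥𝒴 := (q ⁻¹ᵁ V).ι a'
  have hy₁y₀ : y₁ ⤳ y₀ := ha'a.map (q ⁻¹ᵁ V).ι.continuous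
  have hy₁W : y₁ ∈ G ⁻¹ᵁ W := hy₁y₀.mem_open (G ⁻¹ᵁ W).2 hy₀W
  have hqy₁ : q y₁ = cτ pt := by
    change ((q ⁻¹ᵁ V).ι ≫ q) a' = cτ pt
    rw [← morphismRestrict_ι, Scheme.Hom.comp_apply, ha'b]
    rfl
  -- hence the preimage of `W` in the `K`-fibre is non-empty
  have hw : F' (G y₁) = cτ pt := by rw [← Scheme.Hom.comp_apply]; exact hqy₁
  obtain ⟨z, hz, -⟩ := Scheme.Pullback.exists_preimage_pullback (f := F') (g := cτ) (G y₁) pt hw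
  have hne : ((gτ ⁻¹ᵁ W : Xτ.Opens) : Set ↥Xτ).Nonempty :=
    ⟨z, show gτ z ∈ W by rw [show gτ z = G y₁ from hz]; exact hy₁W⟩
  -- ### Step 7: conclude on `(X' ×_R A') ×_{A'} K ≅ Y`
  let e : Xτ ≅ Y :=
    pullbackLeftPullbackSndIso F ιA cτ ≪≫ pullback.congrHom rfl hcτ ≪≫ hsq.isoPullback.symm
  haveI : IrreducibleSpace ↥Xτ :=
    Function.Surjective.irreducibleSpace e.inv.continuous e.inv.surjective
  haveI : IsProper pτ := inferInstance
  haveI : IsNoetherian (pullback G gτ) := isNoetherian_of_locallyOfFiniteType (Gτ ≫ pτ)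
  exact Scheme.HasResolution.of_iso e.hom
    (hasResolution_of_isIso_morphismRestrict Gτ hreg (gτ ⁻¹ᵁ W) hne)

/-! ## The crux conclusion from either family form over a prime model -/

/-- **One-closed-fibre resolution in families over a prime model gives resolution over ALL
algebraically closed fields of characteristic `p`.** If `k` is algebraic over `ZMod p` (e.g.
`AlgebraicClosure (ZMod p)`) with `CampaignW82.FamilyResolutionOneFibre k`, then
`CampaignW82.AlgClosedRes p`: `k` embeds into every algebraically closed `K` of characteristic `p`
(`IsAlgClosed.lift`) and `hasResolution_of_familyResolutionOneFibre` applies. [folklore] -/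
theorem algClosedRes_of_familyResolutionOneFibre (p : ℕ) [Fact p.Prime] (k : Type) [Field k]
    [Algebra (ZMod p) k] [Algebra.IsAlgebraic (ZMod p) k]
    (hOF : CampaignW82.FamilyResolutionOneFibre k) : CampaignW82.AlgClosedRes p := by
  intro K _ _ _ X f hs hl hq hX
  letI : Algebra (ZMod p) K := ZMod.algebra K p
  let ι : k →ₐ[ZMod p] K := IsAlgClosed.lift
  letI : Algebra k K := ι.toRingHom.toAlgebra
  exact hasResolution_of_familyResolutionOneFibre k K hOF X f

/-- **Smooth resolution in families over a prime model gives `AlgClosedRes p`** (via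
`familyResolutionOneFibre_of_smoothFamilyResolution`). [folklore] -/
theorem algClosedRes_of_smoothFamilyResolution (p : ℕ) [Fact p.Prime] (k : Type) [Field k]
    [Algebra (ZMod p) k] [Algebra.IsAlgebraic (ZMod p) k]
    (h : CampaignW82.SmoothFamilyResolution k) : CampaignW82.AlgClosedRes p :=
  algClosedRes_of_familyResolutionOneFibre p k (familyResolutionOneFibre_of_smoothFamilyResolution k h)

end Summit.ResolutionOfSingularities.ResolutionOfSingularities.Theorems.PrimeModelTransfer

end
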